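import Literature.Analysis.FluidPDE.LagrangianLatticeCarrier
import HarnessLib

/-!
# K3L `LagrangianCarrierConstruction` (stmt-AnomalousDissipation-24913): for ONE-DIRECTIONAL carrier data the Lagrangian
# insertion is trivial — `IsLagrangian` forces `b (m+1) = level (m+1)` (helper; `--supports stmt-AnomalousDissipation-24913`)

Summits-side helper file (everything proved; no definitions, no named facts). If every Eulerian level `level m t` of the
bookkeeping datum of a Lagrangian lattice carrier `E` is annihilated by one continuous linear functional `ℓ` on `ℝ³` and is
invariant under the translations of the torus by (the projections of) the vectors of `ker ℓ` — the situation of a word all of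
whose phases share ONE lattice normal `m` (all layers are shears `f(m·x) ê` with `ê ⊥ m`; take `ℓ = ⟨m, ·⟩`) — then the flow /
insertion equations `IsLagrangian` pin the level fields down completely: `b (m+1) = level (m+1)` for every `m`. Indeed,
inductively, the coarse field `b 1 + ⋯ + b m` takes values in `ker ℓ`, so (integral form of the flow) every displacement
`disp m t s x` lies in `ker ℓ`, the coarse flow `X m t s` is a translation along `ker ℓ` fibrewise — under which the levels are
invariant and which is onto — and the derivative of the (translation-invariant) lifted displacement kills `ker ℓ`, so the
pushed-forward level `flowDeriv · level` IS the level. This is the structural half of the refutation of the r22–r23 form of the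
stub `stub_flowsL` (pointwise summability (R0) of `LevelRegular` cannot follow from `Permissible ∧ (W1) ∧ (W2)`); see
`…LagrangianCarrierConstructionFlowsLFalse`. Infrastructure for route-1's rung leaf F-D1.A0 (a frontier FORMAL rung); NOT a
proof of anomalous dissipation.
-/

set_option linter.dupNamespace false

noncomputable section

namespace Summit.AnomalousDissipation.AnomalousDissipation.Theorems.SolenoidalFractalHomogenisation.LagrangianCarrierConstruction

open Set Function Filter Topology MeasureTheory
open Literature.Analysis Literature.Analysis.FunctionSpaces Literature.Analysis.FunctionSpaces.Torus
open Literature.Analysis.FluidPDE Literature.Analysis.FluidPDE.LatticeShear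

variable {k : ℕ}

/-- Every time lies in the refresh window of its floor index. [folklore] -/
theorem mem_window_floor (E : LagrangianLatticeCarrier k) (m : ℕ) (t : ℝ) :
    t ∈ E.window m ⌊t / E.refresh m⌋ := by
  have hR := E.refresh_pos m
  refine ⟨?_, ?_⟩
  · have h := Int.floor_le (t / E.refresh m)
    exact (le_div_iff₀ hR).mp h
  · have h := Int.lt_floor_add_one (t / E.refresh m)
    exact (div_lt_iff₀ hR).mp h

/-- **One-directional data: the Lagrangian insertion is the identity.** If a continuous linear functional `ℓ` kills every
Eulerian level of the datum and every level is invariant under the torus translations by `proj d`, `d ∈ ker ℓ`, then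
`IsLagrangian` forces `b (m+1) t x = level (m+1) t x` for all `m, t, x`.
[cite: ArmstrongVicol2025, §2.2 (PDF p. 18: b_m = b_{m−1} + Σ_l 𝟙 v_m(t, X_{m−1}^{-1}); here X_{m−1} is a shear along the layers)] -/
theorem b_eq_level_of_oneDirectional (E : LagrangianLatticeCarrier k)
    (ℓ : EuclideanSpace ℝ (Fin 3) →L[ℝ] ℝ)
    (hker : ∀ m t x, ℓ (E.toFractalCarrierData.level m t x) = 0)
    (hinv : ∀ m t x (d : EuclideanSpace ℝ (Fin 3)), ℓ d = 0 →
      E.toFractalCarrierData.level m t (x + proj d) = E.toFractalCarrierData.level m t x)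
    (hL : E.IsLagrangian) (m : ℕ) (t : ℝ) (x : UnitAddTorus (Fin 3)) :
    E.b (m + 1) t x = E.toFractalCarrierData.level (m + 1) t x := by
  -- strong induction on the level
  suffices H : ∀ n, ∀ i, i < n → ∀ t x, E.b (i + 1) t x = E.toFractalCarrierData.level (i + 1) t x from
    H (m + 1) m (Nat.lt_succ_self m) t x
  intro n
  induction n with
  | zero => intro i hi; exact absurd hi (Nat.not_lt_zero i)
  | succ n ih =>
    intro i hi t x
    rcases Nat.lt_succ_iff_lt_or_eq.mp hi with hi' | rfl
    · exact ih i hi' t x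
    -- the step: levels `1, …, i` are Eulerian, hence so is level `i + 1`
    have hPS : ∀ r y, E.partialSum i r y =
        ∑ i' ∈ Finset.range i, E.toFractalCarrierData.level (i' + 1) r y := fun r y =>
      Finset.sum_congr rfl fun i' hi' => ih i' (Finset.mem_range.mp hi') r y
    have hPSker : ∀ r y, ℓ (E.partialSum i r y) = 0 := by
      intro r y
      rw [hPS, map_sum]
      exact Finset.sum_eq_zero fun i' _ => hker _ _ _
    have hPSinv : ∀ r y (d : EuclideanSpace ℝ (Fin 3)), ℓ d = 0 →
        E.partialSum i r (y + proj d) = E.partialSum i r y := by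
      intro r y d hd
      rw [hPS, hPS]
      exact Finset.sum_congr rfl fun i' _ => hinv _ _ _ d hd
    have hflow := (hL i).1
    have hins := (hL i).2
    -- every displacement lies in `ker ℓ`
    have hdispker : ∀ t s y, ℓ (E.disp i t s y) = 0 := by
      intro t s y
      rw [hflow t s y]
      by_cases hI : IntervalIntegrable (fun r => E.partialSum i r (E.X i r s y)) volume s t
      · rw [← ℓ.intervalIntegral_comp_comm hI]
        simp only [hPSker, intervalIntegral.integral_zero]
      · rw [intervalIntegral.integral_undef hI, map_zero]
    -- so the displacement is the explicit Eulerian time integral, invariant under `ker ℓ` translations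
    have hdisp : ∀ t s y, E.disp i t s y = ∫ r in s..t, E.partialSum i r y := by
      intro t s y
      rw [hflow t s y]
      refine intervalIntegral.integral_congr fun r _ => ?_
      show E.partialSum i r (E.X i r s y) = E.partialSum i r y
      unfold LagrangianLatticeCarrier.X
      exact hPSinv r y _ (hdispker r s y)
    have hdispinv : ∀ t s y (d : EuclideanSpace ℝ (Fin 3)), ℓ d = 0 →
        E.disp i t s (y + proj d) = E.disp i t s y := by
      intro t s y d hd
      rw [hdisp, hdisp]
      exact intervalIntegral.integral_congr fun r _ => hPSinv r y d hd
    -- the coarse flow maps are onto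
    have hsurj : ∀ t s z, ∃ y, E.X i t s y = z := by
      intro t s z
      refine ⟨z + proj (-E.disp i t s z), ?_⟩
      unfold LagrangianLatticeCarrier.X
      rw [hdispinv t s z _ (by rw [map_neg, hdispker, neg_zero]), add_assoc, ← proj_add, neg_add_cancel,
        proj_zero, add_zero]
    -- the derivative of the lifted displacement kills `ker ℓ`
    have hfd : ∀ t s (z d : EuclideanSpace ℝ (Fin 3)), ℓ d = 0 →
        fderiv ℝ (Torus.lift (E.disp i t s)) z d = 0 := by
      intro t s z d hd
      by_cases hdf : DifferentiableAt ℝ (Torus.lift (E.disp i t s)) z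
      · have hline : HasDerivAt (fun u : ℝ => z + u • d) d 0 := by
          have h := ((hasDerivAt_id (0 : ℝ)).smul_const d).const_add z
          simpa using h
        have hcomp : HasDerivAt (fun u : ℝ => Torus.lift (E.disp i t s) (z + u • d))
            (fderiv ℝ (Torus.lift (E.disp i t s)) z d) 0 := by
          have h := HasFDerivAt.comp_hasDerivAt_of_eq (x := (0 : ℝ)) hdf.hasFDerivAt hline (by simp)
          exact h
        have hconst : (fun u : ℝ => Torus.lift (E.disp i t s) (z + u • d)) =
            fun _ => Torus.lift (E.disp i t s) z := by
          funext u
          simp only [Torus.lift_apply, proj_add]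
          exact hdispinv t s (proj z) _ (by rw [map_smul, hd, smul_zero])
        rw [hconst] at hcomp
        exact hcomp.unique (hasDerivAt_const (0 : ℝ) _)
      · rw [fderiv_zero_of_not_differentiableAt hdf]
        rfl
    -- conclusion on the window containing `t`
    obtain ⟨j, hj⟩ : ∃ j : ℤ, t ∈ E.window (i + 1) j := ⟨_, mem_window_floor E (i + 1) t⟩
    obtain ⟨y, hy⟩ := hsurj t ((j : ℝ) * E.refresh (i + 1)) x
    have h1 := hins j t hj y
    rw [hy] at h1
    rw [h1]
    unfold LagrangianLatticeCarrier.flowDeriv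
    rw [add_apply, ContinuousLinearMap.id_apply, hfd _ _ _ _ (hker _ _ _), add_zero, ← hy]
    unfold LagrangianLatticeCarrier.X
    exact (hinv _ _ _ _ (hdispker _ _ _)).symm

end Summit.AnomalousDissipation.AnomalousDissipation.Theorems.SolenoidalFractalHomogenisation.LagrangianCarrierConstruction

end
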